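import Literature.AlgebraicGeometry.HodgeTheory.AndreottiFrankelAffine
import Literature.AlgebraicTopology.SingularHomology.IntegralBockstein
import Literature.AlgebraicTopology.SingularHomology.UniversalCoefficientsFree
import HarnessLib

/-!
# Andreotti–Frankel, sharp integral form: `H_n(V(ℂ); ℤ)` is torsion-free for a smooth affine `n`-fold

Topic `Literature/AlgebraicGeometry/HodgeTheory` (theorems only; no definition, no named fact).
A. Andreotti, T. Frankel, *The Lefschetz theorem on hyperplane sections*, Ann. of Math. 69 (1959),
Thm. 1: for a Stein manifold (in particular a smooth affine variety) `V` of complex dimension `n`,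
`H_i(V; ℤ) = 0` for `i > n` **and `H_n(V; ℤ)` is torsion-free** (equivalently, Milnor, *Morse
theory* (1963), Thm. 7.2: `V` has the homotopy type of a CW complex of dimension `≤ n`, whose top
homology is free). The tree's `AffineCoordinates.andreottiFrankel_affine` proves the vanishing half
with arbitrary coefficients; this file draws the torsion statement from it by the integral Bockstein
criterion (Hatcher, *Algebraic Topology* (2002), §3.E p. 303, the tree's
`singularHomology.zsmul_right_injective_of_isZero`): `H_{n+1}(V(ℂ); ℤ/d) = 0` for every `d ≥ 1`
(the vanishing half with `ℤ/d`-coefficients), so multiplication by `d` is injective on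
`H_n(V(ℂ); ℤ)`.

* `AffineCoordinates.andreottiFrankel_zsmul_right_injective` — `d •` is injective on
  `H_j(V(ℂ); ℤ)` for `j ≥ n`, `d ≥ 1`;
* `AffineCoordinates.andreottiFrankel_isAddTorsionFree` / `…_isTorsionFree` — `H_j(V(ℂ); ℤ)` has
  no torsion for `j ≥ n` (Andreotti–Frankel Thm. 1, second half; group and `ℤ`-module forms);
* `AffineCoordinates.andreottiFrankel_free_of_finite`, `…_subsingleton_singularCohomology_succ` —
  if moreover `H_n(V(ℂ); ℤ)` is finitely generated (e.g. `V` an affine open of a smooth projective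
  variety) it is FREE, and then `H^{n+1}(V(ℂ); ℤ) = 0` (universal coefficients, Hatcher Thm. 3.2 with `Ext(free, ℤ) = 0` and `H_{n+1} = 0`: the tree's
  `kroneckerPairing_bijective_of_free`), the cohomological form of the sharp theorem;
* `AffineCoordinates.isAddTorsionFree_singularHomology_setOf_pt_mem_affineOpen` (and the module
  form `…isTorsionFree…`) — the same for the complex points over an affine open `U` of a smooth
  variety `X` (the carrier `{P : X(ℂ) | P.pt ∈ U}` of
  `AffineCoordinates.isZero_singularHomology_setOf_pt_mem_affineOpen`).

## References

* [AndreottiFrankel1959] A. Andreotti, T. Frankel, The Lefschetz theorem on hyperplane sections,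
  Ann. of Math. 69 (1959), 713–717, Thm. 1.
* [Milnor1963] J. Milnor, Morse theory (1963), §7 Thm. 7.2.
* [VoisinHodgeII2003] C. Voisin, Hodge Theory and Complex Algebraic Geometry II (2003), §1.2.2
  Thm. 1.22.
* [HatcherAT2002] A. Hatcher, Algebraic Topology (2002), §3.E p. 303, §3.1 Thm. 3.2, Cor. 3.3.
-/

noncomputable section

open CategoryTheory CategoryTheory.Limits AlgebraicGeometry

namespace Literature.AlgebraicGeometry.HodgeTheory

namespace AffineCoordinates

open Literature.AlgebraicGeometry.Motives Literature.AlgebraicTopology.SingularHomology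

/-! ### The torsion half of Andreotti–Frankel's Theorem 1 -/

/-- **Multiplication by `d ≥ 1` is injective on `H_j(V(ℂ); ℤ)`, `j ≥ n`, for `V` smooth affine of
dimension `n`** (Andreotti–Frankel 1959, Thm. 1): `H_{j+1}(V(ℂ); ℤ/d) = 0` by the vanishing half
with `ℤ/d`-coefficients (`andreottiFrankel_affine`), and the Bockstein sequence of
`0 → ℤ → ℤ → ℤ/d → 0` (Hatcher §3.E; the tree's `singularHomology.zsmul_right_injective_of_isZero`).
[cite: AndreottiFrankel1959, Thm. 1] [cite: HatcherAT2002, §3.E p. 303] -/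
theorem andreottiFrankel_zsmul_right_injective {n : ℕ} (V : SchemeOver ℂ) [IsAffine V.left]
    [LocallyOfFiniteType V.hom] [SmoothOfRelativeDimension n V.hom] {j : ℕ} (hj : n ≤ j)
    {d : ℕ} (hd : 0 < d) :
    Function.Injective fun x : singularHomology ℤ ℤ (ComplexPoints V) j => (d : ℤ) • x :=
  singularHomology.zsmul_right_injective_of_isZero hd j
    (andreottiFrankel_affine (n := n) V (R := ℤ) (M₀ := ZMod d) (j := j + 1) (by omega))

/-- **Andreotti–Frankel 1959, Thm. 1 (torsion half), group form: `H_j(V(ℂ); ℤ)` has no torsion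
for `j ≥ n`** (`IsAddTorsionFree`: `d •` is injective for every `d ≠ 0`), `V` smooth affine of
dimension `n` over `ℂ` (for `j > n` the group even vanishes, `andreottiFrankel_affine`).
[cite: AndreottiFrankel1959, Thm. 1] [cite: Milnor1963, §7 Thm. 7.2] -/
theorem andreottiFrankel_isAddTorsionFree {n : ℕ} (V : SchemeOver ℂ) [IsAffine V.left]
    [LocallyOfFiniteType V.hom] [SmoothOfRelativeDimension n V.hom] {j : ℕ} (hj : n ≤ j) :
    IsAddTorsionFree (singularHomology ℤ ℤ (ComplexPoints V) j) := by
  refine ⟨fun d hd x y hxy ↦ ?_⟩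
  refine andreottiFrankel_zsmul_right_injective (n := n) V hj (Nat.pos_of_ne_zero hd) ?_
  change (d : ℤ) • x = (d : ℤ) • y
  rw [natCast_zsmul, natCast_zsmul]
  exact hxy

/-- **Andreotti–Frankel 1959, Thm. 1 (torsion half), module form: `H_j(V(ℂ); ℤ)` is a torsion-free
`ℤ`-module for `j ≥ n`** (for the `ℤ`-module structure of the tree's `singularHomology ℤ ℤ`; all
`ℤ`-module structures on an abelian group coincide). [cite: AndreottiFrankel1959, Thm. 1] -/
theorem andreottiFrankel_isTorsionFree {n : ℕ} (V : SchemeOver ℂ) [IsAffine V.left]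
    [LocallyOfFiniteType V.hom] [SmoothOfRelativeDimension n V.hom] {j : ℕ} (hj : n ≤ j) :
    Module.IsTorsionFree ℤ (singularHomology ℤ ℤ (ComplexPoints V) j) := by
  haveI := andreottiFrankel_isAddTorsionFree (n := n) V hj
  have h : @Module.IsTorsionFree ℤ (singularHomology ℤ ℤ (ComplexPoints V) j) _ _
      (AddCommGroup.toIntModule _) := inferInstance
  first
    | exact h
    | (convert h using 2; exact Subsingleton.elim _ _)

/-- **If moreover `H_j(V(ℂ); ℤ)` is finitely generated it is free** (`j ≥ n`; a finitely generated
torsion-free module over the PID `ℤ`). [cite: AndreottiFrankel1959, Thm. 1] -/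
theorem andreottiFrankel_free_of_finite {n : ℕ} (V : SchemeOver ℂ) [IsAffine V.left]
    [LocallyOfFiniteType V.hom] [SmoothOfRelativeDimension n V.hom] {j : ℕ} (hj : n ≤ j)
    [Module.Finite ℤ (singularHomology ℤ ℤ (ComplexPoints V) j)] :
    Module.Free ℤ (singularHomology ℤ ℤ (ComplexPoints V) j) := by
  haveI := andreottiFrankel_isTorsionFree (n := n) V hj
  infer_instance

/-- **`H^{n+1}(V(ℂ); ℤ) = 0` for `V` smooth affine of dimension `n` with `H_n(V(ℂ); ℤ)` finitely
generated** — the cohomological form of the sharp Andreotti–Frankel theorem: `H_{n+1} = 0` and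
`H_n` free, so the Kronecker map `H^{n+1} → Hom(H_{n+1}, ℤ) = 0` is bijective (Hatcher Thm. 3.2,
`Ext(H_n, ℤ) = 0`; the tree's `kroneckerPairing_bijective_of_free`). (For degrees `≥ n + 2` no
finiteness is needed: `H_{k-1} = H_k = 0`.) [cite: AndreottiFrankel1959, Thm. 1]
[cite: HatcherAT2002, §3.1 Thm. 3.2] -/
theorem andreottiFrankel_subsingleton_singularCohomology_succ {n : ℕ} (V : SchemeOver ℂ)
    [IsAffine V.left] [LocallyOfFiniteType V.hom] [SmoothOfRelativeDimension n V.hom]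
    [Module.Finite ℤ (singularHomology ℤ ℤ (ComplexPoints V) n)] :
    Subsingleton (singularCohomology ℤ ℤ (ComplexPoints V) (n + 1)) := by
  haveI := andreottiFrankel_free_of_finite (n := n) V (j := n) le_rfl
  have h1 : IsZero (singularHomology ℤ ℤ (ComplexPoints V) (n + 1)) :=
    andreottiFrankel_affine (n := n) V (by omega)
  haveI := ModuleCat.subsingleton_of_isZero h1
  haveI : Subsingleton (singularHomology ℤ ℤ (ComplexPoints V) (n + 1) →ₗ[ℤ] ℤ) :=
    ⟨fun f g ↦ LinearMap.ext fun x ↦ by rw [Subsingleton.elim x 0, map_zero, map_zero]⟩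
  exact (kroneckerPairing_bijective_of_free ℤ (ComplexPoints V) n).1.subsingleton

/-! ### Affine opens of a smooth variety -/

/-- **No torsion in `H_j`, `j ≥ n`, of the complex points over an affine open of a smooth variety of
dimension `n`** (the carrier `{P : X(ℂ) | P.pt ∈ U} ≃ₜ U(ℂ)` of
`isZero_singularHomology_setOf_pt_mem_affineOpen`). [cite: AndreottiFrankel1959, Thm. 1]
[cite: VoisinHodgeII2003, §1.2.2 Thm. 1.22] -/
theorem isAddTorsionFree_singularHomology_setOf_pt_mem_affineOpen {n : ℕ} (X : SchemeOver ℂ)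
    [LocallyOfFiniteType X.hom] [SmoothOfRelativeDimension n X.hom] (U : X.left.Opens)
    (hU : IsAffineOpen U) {j : ℕ} (hj : n ≤ j) :
    IsAddTorsionFree (singularHomology ℤ ℤ ↥{P : ComplexPoints X | P.pt ∈ (U : Set X.left)} j) := by
  set W := openSubschemeOver X U with hW
  haveI : IsAffine W.left := hU
  haveI : IsOpenImmersion (openSubschemeOverι X U).left := inferInstanceAs (IsOpenImmersion U.ι)
  haveI : LocallyOfFiniteType W.hom := ComplexPoints.locallyOfFiniteType_hom_of_hom (openSubschemeOverι X U)
  haveI : SmoothOfRelativeDimension n W.hom := by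
    have := ComplexPoints.smoothOfRelativeDimension_hom_of_hom (openSubschemeOverι X U) 0 n
    rwa [zero_add] at this
  have h0 := andreottiFrankel_isAddTorsionFree (n := n) W hj
  -- `W(ℂ) ≃ₜ {P ∈ X(ℂ) | P.pt ∈ U}`
  have hemb : Topology.IsEmbedding (AlgPoints.map (L := ℂ) (openSubschemeOverι X U)) :=
    AlgPoints.isEmbedding_map _
  have hrange : Set.range (AlgPoints.map (L := ℂ) (openSubschemeOverι X U)) =
      {P : ComplexPoints X | P.pt ∈ (U : Set X.left)} := by
    rw [AlgPoints.range_map_of_isOpenImmersion_holds]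
    ext P
    change P.pt ∈ U.ι.opensRange ↔ P.pt ∈ (U : Set X.left)
    rw [Scheme.Opens.opensRange_ι]
    rfl
  let e : ComplexPoints W ≃ₜ ↥{P : ComplexPoints X | P.pt ∈ (U : Set X.left)} :=
    hemb.toHomeomorph.trans (Homeomorph.setCongr hrange)
  let ι : singularHomology ℤ ℤ (ComplexPoints W) j ≅
      singularHomology ℤ ℤ ↥{P : ComplexPoints X | P.pt ∈ (U : Set X.left)} j :=
    (HomologicalComplex.homologyFunctor _ _ j).mapIso (singularChainComplex.mapHomeomorph ℤ ℤ e)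
  refine ⟨fun d hd x y hxy ↦ ?_⟩
  have hinj : Function.Injective fun z ↦ ι.inv z := ι.toLinearEquiv.symm.injective
  refine hinj (h0.nsmul_right_injective hd ?_)
  change d • (ModuleCat.Hom.hom ι.inv) x = d • (ModuleCat.Hom.hom ι.inv) y
  rw [← map_nsmul, ← map_nsmul]
  exact congrArg (fun z ↦ (ModuleCat.Hom.hom ι.inv) z) hxy

/-- The same in module form (`Module.IsTorsionFree ℤ`). [cite: AndreottiFrankel1959, Thm. 1] -/
theorem isTorsionFree_singularHomology_setOf_pt_mem_affineOpen {n : ℕ} (X : SchemeOver ℂ)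
    [LocallyOfFiniteType X.hom] [SmoothOfRelativeDimension n X.hom] (U : X.left.Opens)
    (hU : IsAffineOpen U) {j : ℕ} (hj : n ≤ j) :
    Module.IsTorsionFree ℤ (singularHomology ℤ ℤ ↥{P : ComplexPoints X | P.pt ∈ (U : Set X.left)} j) := by
  haveI := isAddTorsionFree_singularHomology_setOf_pt_mem_affineOpen (n := n) X U hU hj
  have h : @Module.IsTorsionFree ℤ
      (singularHomology ℤ ℤ ↥{P : ComplexPoints X | P.pt ∈ (U : Set X.left)} j) _ _
      (AddCommGroup.toIntModule _) := inferInstance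
  first
    | exact h
    | (convert h using 2; exact Subsingleton.elim _ _)

end AffineCoordinates

end Literature.AlgebraicGeometry.HodgeTheory

end
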